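import Summits.CriticalPhenomena.PercolationContinuityZ3.Theorems.PercNearOneGluingNoHeavyLowerTailSahiThreeCopySubstitution
import Summits.CriticalPhenomena.PercolationContinuityZ3.Theorems.PercNearOneGluingNoHeavyLowerTailSahiThreeCopyCubeFour

/-!
# `NoHeavyLowerTail` (crux stmt-CriticalPhenomena-4575), Sahi programme: **COORDINATE PERMUTATIONS and the SUBSTITUTION
# INSTANCES OF THE `≤ 4`-VARIABLE TRIPLES** — `c_b` is invariant under renaming coordinates, so the blockwise substitution
# closure (`…Substitution`) applies at every variable; fed with `…CubeFour` it settles 3C-SAHI for every blockwise-monotone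
# substitution instance of a nonnegative monotone triple on `{0,1}^{≤4}`

Support file (Sahi cell, seat `prim-sahi-p1`, generation 55; `--supports stmt-CriticalPhenomena-4575`).  COMPUTATIONAL through
`…CubeFour` (`checkCube_four`, `native_decide`, generation 1).
* `rePt`, `rePtEquiv`, `isArr_rePt_iff`, `N3_reindex`, `tc_reindex` — for a permutation `τ` of the coordinates,
  `c_{b∘τ⁻¹}(f∘τ*, g∘τ*, h∘τ*) = c_b(f,g,h)` with `(τ* x)_j = x_{τ j}`: the three-copy coefficient only sees the multiset of
  (coordinate, profile entry) pairs; `threeCopyGood_reindex` (so `…Substitution.threeCopyGood_subst`, stated for the first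
  variable, substitutes any variable after a renaming).
* `threeCopyGood_of_le_four` — every nonnegative monotone triple on `{0,1}^m`, `m ≤ 4`, is 3C-good (`tc_nonneg_of_le_four`).
* `threeCopyGood_subst_of_le_four` — hence `(subst σ f, subst σ g, subst σ h)` is 3C-good for every monotone `σ : {0,1}^e → Bool`
  and every nonnegative monotone `(f,g,h)` on `{0,1}^{d+1}`, `d + 1 ≤ 4`; iterating substitutes every variable: all triples
  `(σ₁∨σ₂σ₃, σ₂∨σ₄, σ₁σ₄∨σ₃)`, `(σ₁(σ₂∨σ₃), σ₂(σ₁∨σ₃), σ₃(σ₁∨σ₂))` (the dual gadget with blocks), … with arbitrary monotone block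
  functions `σ_i` on pairwise disjoint blocks satisfy 3C-SAHI at every profile.
[this work]
-/

namespace Summit.CriticalPhenomena.PercolationContinuityZ3.Theorems.SahiThreeCopy

open Finset Function Literature.Combinatorics.Sahi2008
open scoped BigOperators

noncomputable section

variable {n d : ℕ}

/-! ### §1 Renaming coordinates -/

/-- Pull a point back along a coordinate permutation: `(rePt τ x)_j = x_{τ j}`. [this work] -/
def rePt (τ : Fin n ≃ Fin n) (x : Pt n) : Pt n := fun j => x (τ j)

/-- `rePt τ⁻¹ ∘ rePt τ = id`. [this work] -/
theorem rePt_symm_rePt (τ : Fin n ≃ Fin n) (x : Pt n) : rePt τ.symm (rePt τ x) = x := by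
  funext j; simp [rePt]

/-- `rePt τ ∘ rePt τ⁻¹ = id`. [this work] -/
theorem rePt_rePt_symm (τ : Fin n ≃ Fin n) (x : Pt n) : rePt τ (rePt τ.symm x) = x := by
  funext j; simp [rePt]

/-- `rePt τ` is a bijection of the cube. [this work] -/
def rePtEquiv (τ : Fin n ≃ Fin n) : Pt n ≃ Pt n where
  toFun := rePt τ
  invFun := rePt τ.symm
  left_inv := rePt_symm_rePt τ
  right_inv := rePt_rePt_symm τ

/-- `rePt` is monotone. [this work] -/
theorem rePt_mono (τ : Fin n ≃ Fin n) : Monotone (rePt τ) := fun _ _ hxy j => hxy (τ j)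

/-- Arrangements are renamed coordinatewise: `(τ*x, τ*y, τ*z)` is an arrangement of `b ∘ τ` iff `(x,y,z)` is one of `b`. [this work] -/
theorem isArr_rePt_iff (τ : Fin n ≃ Fin n) (b : Fin n → ℕ) (x y z : Pt n) :
    IsArr (fun j => b (τ j)) (rePt τ x) (rePt τ y) (rePt τ z) ↔ IsArr b x y z := by
  unfold IsArr rePt
  constructor
  · intro h i
    have := h (τ.symm i)
    simpa using this
  · intro h j
    exact h (τ j)

/-- **`N_b` is invariant under renaming coordinates**: `N_{b∘τ⁻¹}(f∘τ*; g∘τ*; h∘τ*) = N_b(f;g;h)`. [this work] -/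
theorem N3_reindex (τ : Fin n ≃ Fin n) (b : Fin n → ℕ) (f g h : Pt n → ℝ) :
    N3 (fun j => b (τ.symm j)) (fun x => f (rePt τ x)) (fun x => g (rePt τ x)) (fun x => h (rePt τ x)) = N3 b f g h := by
  unfold N3
  rw [← (rePtEquiv τ.symm).sum_comp]
  refine sum_congr rfl fun x _ => ?_
  rw [← (rePtEquiv τ.symm).sum_comp]
  refine sum_congr rfl fun y _ => ?_
  rw [← (rePtEquiv τ.symm).sum_comp]
  refine sum_congr rfl fun z _ => ?_
  show (if IsArr (fun j => b (τ.symm j)) (rePt τ.symm x) (rePt τ.symm y) (rePt τ.symm z) then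
      f (rePt τ (rePt τ.symm x)) * g (rePt τ (rePt τ.symm y)) * h (rePt τ (rePt τ.symm z)) else 0) =
    if IsArr b x y z then f x * g y * h z else 0
  rw [if_congr (isArr_rePt_iff τ.symm b x y z) rfl rfl, rePt_rePt_symm, rePt_rePt_symm, rePt_rePt_symm]

/-- **`c_b` is invariant under renaming coordinates.** [this work] -/
theorem tc_reindex (τ : Fin n ≃ Fin n) (b : Fin n → ℕ) (f g h : Pt n → ℝ) :
    tc (fun j => b (τ.symm j)) (fun x => f (rePt τ x)) (fun x => g (rePt τ x)) (fun x => h (rePt τ x)) = tc b f g h := by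
  unfold tc
  have e3 : (fun x => f (rePt τ x)) * (fun x => g (rePt τ x)) * (fun x => h (rePt τ x)) =
      fun x => (f * g * h) (rePt τ x) := by funext x; rfl
  have egh : (fun x => g (rePt τ x)) * (fun x => h (rePt τ x)) = fun x => (g * h) (rePt τ x) := by funext x; rfl
  have efh : (fun x => f (rePt τ x)) * (fun x => h (rePt τ x)) = fun x => (f * h) (rePt τ x) := by funext x; rfl
  have efg : (fun x => f (rePt τ x)) * (fun x => g (rePt τ x)) = fun x => (f * g) (rePt τ x) := by funext x; rfl
  have e1 : (1 : Pt n → ℝ) = fun x => (1 : Pt n → ℝ) (rePt τ x) := by funext x; rfl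
  rw [e3, egh, efh, efg]
  conv_lhs => rw [e1]
  simp only [N3_reindex]

/-- 3C-good triples stay good under renaming coordinates (every profile of the renamed triple is `b ∘ τ⁻¹` for some `b`). [this work] -/
theorem threeCopyGood_reindex (τ : Fin n ≃ Fin n) {f g h : Pt n → ℝ} (H : ThreeCopyGood f g h) :
    ThreeCopyGood (fun x => f (rePt τ x)) (fun x => g (rePt τ x)) (fun x => h (rePt τ x)) := by
  obtain ⟨hf, hg, hh, hfm, hgm, hhm, htc⟩ := H
  refine ⟨fun x => hf _, fun x => hg _, fun x => hh _, fun x y hxy => hfm (rePt_mono τ hxy),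
    fun x y hxy => hgm (rePt_mono τ hxy), fun x y hxy => hhm (rePt_mono τ hxy), fun b => ?_⟩
  have e : b = fun j => (fun i => b (τ i)) (τ.symm j) := by funext j; simp
  rw [e, tc_reindex τ (fun i => b (τ i))]
  exact htc _

/-! ### §2 The substitution instances of the `≤ 4`-variable triples -/

/-- Every nonnegative monotone triple on `{0,1}^m`, `m ≤ 4`, is 3C-good (`…CubeFour`). [this work] -/
theorem threeCopyGood_of_le_four {m : ℕ} (hm : m ≤ 4) {f g h : Pt m → ℝ} (hf : ∀ x, 0 ≤ f x) (hg : ∀ x, 0 ≤ g x)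
    (hh : ∀ x, 0 ≤ h x) (hfm : Monotone f) (hgm : Monotone g) (hhm : Monotone h) : ThreeCopyGood f g h :=
  ⟨hf, hg, hh, hfm, hgm, hhm, fun b => tc_nonneg_of_le_four hm b hf hg hh hfm hgm hhm⟩

/-- **3C-SAHI for the blockwise substitution instances of the `≤ 4`-variable triples** (one variable substituted; iterate after
`threeCopyGood_reindex` for the others): for `d + 1 ≤ 4`, nonnegative monotone `f, g, h : {0,1}^{d+1} → ℝ` and a monotone
`σ : {0,1}^e → Bool`, the triple `(subst σ f, subst σ g, subst σ h)` on `{0,1}^{d+e}` satisfies `c_B ≥ 0` at EVERY profile `B`. [this work] -/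
theorem threeCopyGood_subst_of_le_four (hd : d + 1 ≤ 4) (e : ℕ) {σ : Pt e → Bool} (hσ : Monotone σ) {f g h : Pt (d + 1) → ℝ}
    (hf : ∀ x, 0 ≤ f x) (hg : ∀ x, 0 ≤ g x) (hh : ∀ x, 0 ≤ h x) (hfm : Monotone f) (hgm : Monotone g) (hhm : Monotone h) :
    ThreeCopyGood (subst e σ f) (subst e σ g) (subst e σ h) :=
  threeCopyGood_subst e hσ (threeCopyGood_of_le_four hd hf hg hh hfm hgm hhm)

/-- The bare coefficient statement of the previous theorem. [this work] -/
theorem tc_subst_nonneg_of_le_four (hd : d + 1 ≤ 4) (e : ℕ) {σ : Pt e → Bool} (hσ : Monotone σ) {f g h : Pt (d + 1) → ℝ}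
    (hf : ∀ x, 0 ≤ f x) (hg : ∀ x, 0 ≤ g x) (hh : ∀ x, 0 ≤ h x) (hfm : Monotone f) (hgm : Monotone g) (hhm : Monotone h)
    (B : Fin (d + e) → ℕ) : 0 ≤ tc B (subst e σ f) (subst e σ g) (subst e σ h) :=
  (threeCopyGood_subst_of_le_four hd e hσ hf hg hh hfm hgm hhm).2.2.2.2.2.2 B

end

end Summit.CriticalPhenomena.PercolationContinuityZ3.Theorems.SahiThreeCopy
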